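import Mathlib
import HarnessLib
import Summits.HubbardSuperconductivity.HubbardSuperconductivity.Theorems.KLProgrammeKLRegimeTwoVolumeSectionalMomentScaleZero
import Summits.HubbardSuperconductivity.HubbardSuperconductivity.Theorems.KLProgrammeKLRegimeTwoVolumeResummedSymbolSizesFrameOK

/-!
# β′ two-volume pass at a GENERAL scale in the KL regime: the ε-free sectional data of the one-shot covariance `S_LᵀC^{K}_{>Λ}S_L` of an
# ADMISSIBLE frame (`FrameOK`), TURNKEY — cell gate-hubbard-kl, seat hubbard-kl-k3c4-p2 (g7)

The (E3f-F) STEP at the scales `n ≥ 1` (one-shot scheme F-II: the scale-`n` action is `effAction (S_{N}ᵀ C^{K_n}_{>Λ_n} S_N) (…)` in the flow frame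
`K_n`) and the (A3) inductive two-volume comparison read the same one-volume datum as the scale-`0` leg: the FIXED-TIME far spatial sums of the
pulled-back ultraviolet covariance above `Λ` in the frame `K` (k3c5-p2's `hsec`) and its sup entry (`hs`).  `…TwoVolumeSectionalMoment` bounds the
former for any frame with band sizes `‖Dⁱe_K‖ ≤ Dⁱ`; k3c5-p1's `band_graded_of_frameOK` supplies `D = 5 + Gfr₃U²·4^{N+1}/3` for every admissible
frame in the KL regime.  Composition:

* **`sum_far_norm_gridSub_hubbardCovAboveCT_sectional_le_of_frameOK`** — for `∀ j, 0 ≤ R.Gfr j`, `0 < c ≤ klCurveC3 R`, `0 < U ≤ klCurveU0 R`,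
  `klBetaMin ≤ β ≤ e^{c/U²}`, `μ ∈ klWindowC`, `FrameOK R U (nScales β) μ K`, any `0 < Λ`, any grid `N ≥ 2M`, any `R₀`:
  `Σ_{y : R₀ < tnorm(x′−y)} ‖(S_LᵀC^K_{>Λ}S_L) X′ (((t,y),σ),c)‖ ≤ 96·3960000·(2π(1+4/Λ)D + 12π²(1+4/Λ)²D² + 144π³(1+4/Λ)³D³)/Λ/(R₀+1)`,
  `D = 5 + R.Gfr 3·U²·(4^{nScales β+1}/3)` — uniform in `M`, `L`, the times;
* `sum_tnorm_mul_norm_gridSub_hubbardCovAboveCT_sectional_le_of_frameOK` — the underlying `tnorm`-first moment;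
* `sum_tnorm_mul_norm_gridSub_hubbardCovSliceCT_sectional_le_of_frameOK` — the slice twin `C^K_{(Λ,Λ′]}`.

Proofs only; no definitions; nothing about the model beyond bounds.  References: BGM 2006 §2.1, Lemma 2.2 [cite: BenfattoGiulianiMastropietro2006].
-/

noncomputable section

namespace Summit.HubbardSuperconductivity.HubbardSuperconductivity.Theorems.TwoVolumeDefect

set_option linter.dupNamespace false -- summit = problem name (single-conjunct summit), D-0017

open Finset Complex Literature.MathematicalPhysics.QuantumLattice Literature.Probability.LatticeModels
open Summit.HubbardSuperconductivity.HubbardSuperconductivity.Theorems.KLRegimeSplit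
open Summit.HubbardSuperconductivity.HubbardSuperconductivity.Theorems.DispersionFlow
open Summit.HubbardSuperconductivity.HubbardSuperconductivity.Theorems.PerturbedFermiCurve
open scoped Nat

variable {L M N : ℕ} [NeZero L] [NeZero N]

/-- **The sectional `tnorm`-first moment of `S_LᵀC^K_{>Λ}S_L` for an ADMISSIBLE frame in the KL regime** (band sizes from
`band_graded_of_frameOK`, cutoff numerals `≤ 3960000`): for every grid `N ≥ 2M`, every `0 < Λ`, leg, time, spin, charge. -/
theorem sum_tnorm_mul_norm_gridSub_hubbardCovAboveCT_sectional_le_of_frameOK (hN : 2 * M ≤ N) {R : RenConsts} (hR : ∀ j, 0 ≤ R.Gfr j)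
    {c : ℝ} (hc : 0 < c) (hcle : c ≤ klCurveC3 R) {U : ℝ} (hU : 0 < U) (hUle : U ≤ klCurveU0 R) {β : ℝ} (hβmin : klBetaMin ≤ β)
    (hβc : β ≤ Real.exp (c / U ^ 2)) {μ : ℝ} (hμ : μ ∈ klWindowC) {K : TrigPolyC4v} (hK : FrameOK R U (nScales β) μ K) {Λ : ℝ} (hΛ : 0 < Λ)
    (X' : GridLeg (GridPoint L N)) (t : Fin N) (σ ch : Fin 2) :
    ∑ y : TorusSite 2 L, (Torus.tnorm (X'.1.1.2 - y) : ℝ) *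
        ‖((hubbardGridSub L M β N).transpose * hubbardCovAboveCT L M β μ 0 K Λ * hubbardGridSub L M β N) X' (((t, y), σ), ch)‖ ≤
      96 * 3960000 * (2 * Real.pi * (1 + 4 / Λ) * (5 + R.Gfr 3 * U ^ 2 * ((4 : ℝ) ^ (nScales β + 1) / 3)) +
        12 * Real.pi ^ 2 * (1 + 4 / Λ) ^ 2 * (5 + R.Gfr 3 * U ^ 2 * ((4 : ℝ) ^ (nScales β + 1) / 3)) ^ 2 +
        144 * Real.pi ^ 3 * (1 + 4 / Λ) ^ 3 * (5 + R.Gfr 3 * U ^ 2 * ((4 : ℝ) ^ (nScales β + 1) / 3)) ^ 3) / Λ := by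
  have hβ : 0 < β := lt_of_lt_of_le (by norm_num [klBetaMin]) hβmin
  have hD0 : 0 ≤ 5 + R.Gfr 3 * U ^ 2 * ((4 : ℝ) ^ (nScales β + 1) / 3) := by have := hR 3; positivity
  exact sum_tnorm_mul_norm_gridSub_hubbardCovAboveCT_sectional_le hN hβ hΛ (by norm_num) norm_iteratedDeriv_salmhoferCutoff_le_numeral hD0
    (band_graded_of_frameOK hR hc hcle hU hUle hβmin hβc hμ hK) X' t σ ch

/-- **`hsec` AT A GENERAL SCALE FOR AN ADMISSIBLE FRAME** — the fixed-time far spatial sums of `S_LᵀC^K_{>Λ}S_L`: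
`Σ_{y : R₀ < tnorm(x′−y)} ‖…‖ ≤ 96·3960000·(2π(1+4/Λ)D + 12π²(1+4/Λ)²D² + 144π³(1+4/Λ)³D³)/Λ/(R₀+1)`, `D = 5 + Gfr₃U²4^{N+1}/3`. -/
theorem sum_far_norm_gridSub_hubbardCovAboveCT_sectional_le_of_frameOK (hN : 2 * M ≤ N) {R : RenConsts} (hR : ∀ j, 0 ≤ R.Gfr j)
    {c : ℝ} (hc : 0 < c) (hcle : c ≤ klCurveC3 R) {U : ℝ} (hU : 0 < U) (hUle : U ≤ klCurveU0 R) {β : ℝ} (hβmin : klBetaMin ≤ β)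
    (hβc : β ≤ Real.exp (c / U ^ 2)) {μ : ℝ} (hμ : μ ∈ klWindowC) {K : TrigPolyC4v} (hK : FrameOK R U (nScales β) μ K) {Λ : ℝ} (hΛ : 0 < Λ)
    (R₀ : ℕ) (X' : GridLeg (GridPoint L N)) (t : Fin N) (σ ch : Fin 2) :
    ∑ y ∈ univ.filter (fun y : TorusSite 2 L => R₀ < Torus.tnorm (X'.1.1.2 - y)),
        ‖((hubbardGridSub L M β N).transpose * hubbardCovAboveCT L M β μ 0 K Λ * hubbardGridSub L M β N) X' (((t, y), σ), ch)‖ ≤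
      96 * 3960000 * (2 * Real.pi * (1 + 4 / Λ) * (5 + R.Gfr 3 * U ^ 2 * ((4 : ℝ) ^ (nScales β + 1) / 3)) +
        12 * Real.pi ^ 2 * (1 + 4 / Λ) ^ 2 * (5 + R.Gfr 3 * U ^ 2 * ((4 : ℝ) ^ (nScales β + 1) / 3)) ^ 2 +
        144 * Real.pi ^ 3 * (1 + 4 / Λ) ^ 3 * (5 + R.Gfr 3 * U ^ 2 * ((4 : ℝ) ^ (nScales β + 1) / 3)) ^ 3) / Λ / ((R₀ : ℝ) + 1) := by
  have hβ : 0 < β := lt_of_lt_of_le (by norm_num [klBetaMin]) hβmin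
  have hD0 : 0 ≤ 5 + R.Gfr 3 * U ^ 2 * ((4 : ℝ) ^ (nScales β + 1) / 3) := by have := hR 3; positivity
  exact sum_far_norm_gridSub_hubbardCovAboveCT_sectional_le hN hβ hΛ (by norm_num) norm_iteratedDeriv_salmhoferCutoff_le_numeral hD0
    (band_graded_of_frameOK hR hc hcle hU hUle hβmin hβc hμ hK) R₀ X' t σ ch

/-- **The slice twin for an admissible frame**: the sectional `tnorm`-first moment of `S_LᵀC^K_{(Λ,Λ′]}S_L` is at most the sum of the two
ultraviolet bounds at `Λ` and `Λ′`. -/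
theorem sum_tnorm_mul_norm_gridSub_hubbardCovSliceCT_sectional_le_of_frameOK (hN : 2 * M ≤ N) {R : RenConsts} (hR : ∀ j, 0 ≤ R.Gfr j)
    {c : ℝ} (hc : 0 < c) (hcle : c ≤ klCurveC3 R) {U : ℝ} (hU : 0 < U) (hUle : U ≤ klCurveU0 R) {β : ℝ} (hβmin : klBetaMin ≤ β)
    (hβc : β ≤ Real.exp (c / U ^ 2)) {μ : ℝ} (hμ : μ ∈ klWindowC) {K : TrigPolyC4v} (hK : FrameOK R U (nScales β) μ K) {Λ Λ' : ℝ}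
    (hΛ : 0 < Λ) (hΛ' : 0 < Λ') (X' : GridLeg (GridPoint L N)) (t : Fin N) (σ ch : Fin 2) :
    ∑ y : TorusSite 2 L, (Torus.tnorm (X'.1.1.2 - y) : ℝ) *
        ‖((hubbardGridSub L M β N).transpose * hubbardCovSliceCT L M β μ 0 K Λ Λ' * hubbardGridSub L M β N) X' (((t, y), σ), ch)‖ ≤
      96 * 3960000 * (2 * Real.pi * (1 + 4 / Λ) * (5 + R.Gfr 3 * U ^ 2 * ((4 : ℝ) ^ (nScales β + 1) / 3)) +
        12 * Real.pi ^ 2 * (1 + 4 / Λ) ^ 2 * (5 + R.Gfr 3 * U ^ 2 * ((4 : ℝ) ^ (nScales β + 1) / 3)) ^ 2 +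
        144 * Real.pi ^ 3 * (1 + 4 / Λ) ^ 3 * (5 + R.Gfr 3 * U ^ 2 * ((4 : ℝ) ^ (nScales β + 1) / 3)) ^ 3) / Λ +
      96 * 3960000 * (2 * Real.pi * (1 + 4 / Λ') * (5 + R.Gfr 3 * U ^ 2 * ((4 : ℝ) ^ (nScales β + 1) / 3)) +
        12 * Real.pi ^ 2 * (1 + 4 / Λ') ^ 2 * (5 + R.Gfr 3 * U ^ 2 * ((4 : ℝ) ^ (nScales β + 1) / 3)) ^ 2 +
        144 * Real.pi ^ 3 * (1 + 4 / Λ') ^ 3 * (5 + R.Gfr 3 * U ^ 2 * ((4 : ℝ) ^ (nScales β + 1) / 3)) ^ 3) / Λ' := by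
  have hβ : 0 < β := lt_of_lt_of_le (by norm_num [klBetaMin]) hβmin
  have hD0 : 0 ≤ 5 + R.Gfr 3 * U ^ 2 * ((4 : ℝ) ^ (nScales β + 1) / 3) := by have := hR 3; positivity
  exact sum_tnorm_mul_norm_gridSub_hubbardCovSliceCT_sectional_le hN hβ hΛ hΛ' (by norm_num) norm_iteratedDeriv_salmhoferCutoff_le_numeral hD0
    (band_graded_of_frameOK hR hc hcle hU hUle hβmin hβc hμ hK) X' t σ ch

end Summit.HubbardSuperconductivity.HubbardSuperconductivity.Theorems.TwoVolumeDefect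

end
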